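/-
Origin: expansion seat `planner-pub-hodgecm-pv05-g3-0`, handover #5 v2 2026-08-18T06:03:50Z (`HOME/pub-hodgecm-pv05-g3/lean/Pv05g3/FockPairing.lean`, md5 8ec56b58, 328 lines);
landed by the gen-6 packager in gate run 24 as `HodgeCM/PerL34/FockPairing.lean` (verbatim).
-/
/-
Origin: HOME/pub-hodgecm-pv05-g3/lean/Pv05g3/FockPairing.lean — session planner-pub-hodgecm-pv05-g3-0 (unit
pub-hodgecm-pv05-g3, DAG-node prover #05 gen 3).  Intended final place: `HodgeCM/PerL34/FockPairing.lean`
(namespace `HodgeCM.PerL34.Fock`).  Imports the LANDED `HodgeCM.PerL34.FockGL3` (run 23) and Mathlib only — no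
`Pv05g3.*` import left to rewrite; asserts nothing.
-/
import Mathlib.Data.Complex.BigOperators
import Summits.HodgeConjecture.HodgeCM.PerL34.FockGL3

set_option autoImplicit false

/-!
# The Fock inner product on `ℂ[z₁, z₂, w]`: transpose relations of the oscillator operators, orthogonality of the `F_k`, positivity

The unitarity half of Howe duality on the polynomial Fock space, KERNEL and hypothesis-free.  For any finite
variable set `σ`:

* `fischer : ℂ[X_σ] →ₗ ℂ[X_σ] →ₗ ℂ`, the **Fischer (Fock, contravariant) pairing** `⟪f, g⟫ = Σ_m m! f_m g_m`
  (`fischer_monomial_monomial`, `fischer_eq_sum`, `fischer_monomial_right`); symmetric (`fischer_symm`),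
  non-degenerate (`fischer_nondegenerate`);
* **`fischer_X_mul : ⟪X_i f, g⟫ = ⟪f, ∂_i g⟫`** — multiplication and differentiation are mutually transpose
  (`fischer_pderiv`, `fischer_X_mul_pderiv`, `fischer_weightOp`);
* **`fischer_eq_zero_of_mem_wpiece`**: distinct weight pieces are orthogonal;
* the Hermitian version `⟪f, ḡ⟫` (`ḡ = MvPolynomial.map conj g`) is the Bargmann–Fock inner product:
  `fischer_conj_self : ⟪f, f̄⟫ = Σ_m m! |f_m|²`, real (`fischer_conj_self_im`) and **positive definite**
  (`fischer_conj_self_pos`, `eq_zero_of_fischer_conj_self_eq_zero`).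

On `ℂ[z₁,z₂,w]` (the pair `(U(1), U(2,1))`, operators of `FockIrreducible` / `FockGL3`):

* `fischer_hE : ⟪E_{ab} f, g⟫ = ⟪f, E_{ba} g⟫`, `fischer_hH`, **`fischer_hP : ⟪P_a f, g⟫ = ⟪f, Q_a g⟫`** (creation
  `z_a w ·` and annihilation `∂_{z_a}∂_w` are mutually transpose), `fischer_hQ`;
* **`fischer_eq_zero_of_mem_hpiece : k ≠ k' → F_k ⟂ F_{k'}`**;
* **`fischer_osc : ⟪osc_{ij} f, g⟫ = J_i J_j ⟪f, osc_{ji} g⟫`** with `J = diag(1,1,−1)` (`blockSign`, `jsign`,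
  `jmat`), in matrix form **`fischer_oscRep : ⟪oscRep A f, g⟫ = ⟪f, oscRep (J Aᵀ J) g⟫**: the real form `𝔲(2,1) = {A : J Āᵀ J = −A}` of `𝔤𝔩₃(ℂ)` acts on every `F_k` by operators
  that are skew-Hermitian for the positive definite Fock inner product — the formal (𝔤,K)-module unitarity of
  `θ_k = F_k`.  (Identifying this inner product with the `L²`-structure of the Schrödinger / Fock model of the
  metaplectic representation is DICTIONARY, as in `FockIrreducible`.)

And for the definite pair `(U(1), U(3))` on `ℂ[z₁,z₂,z₃]`: `fischer_dE`, **`fischer_dERep : ⟪dERep A f, g⟫ =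
⟪f, dERep Aᵀ g⟫`** (`𝔲(3)` acts skew-Hermitian), `fischer_eq_zero_of_mem_dpiece` (`Sym^d ⟂ Sym^{d'}`).

PACKAGER: no import rewrite needed (imports the landed run-23 tree).
-/

namespace HodgeCM

namespace PerL34

namespace Fock

open MvPolynomial Finsupp

open scoped BigOperators

section Pairing

variable {σ : Type*} [Fintype σ] [DecidableEq σ]

/-- the factorial weight `m! = ∏_j (m_j)!` of an exponent vector -/
noncomputable def mfact (m : σ →₀ ℕ) : ℂ := ∏ j, ((m j).factorial : ℂ)

omit [DecidableEq σ] in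
/-- (Ported verbatim from the HodgeCMPerL package; no docstring in the source.) -/
theorem mfact_ne_zero (m : σ →₀ ℕ) : mfact m ≠ 0 :=
  Finset.prod_ne_zero_iff.mpr fun _ _ => Nat.cast_ne_zero.mpr (Nat.factorial_ne_zero _)

/-- (Ported verbatim from the HodgeCMPerL package; no docstring in the source.) -/
theorem mfact_add_single (m : σ →₀ ℕ) (i : σ) :
    mfact (m + single i 1) = ((m i + 1 : ℕ) : ℂ) * mfact m := by
  unfold mfact
  rw [Fintype.prod_eq_mul_prod_compl i, Fintype.prod_eq_mul_prod_compl i (fun j => ((m j).factorial : ℂ))]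
  rw [Finsupp.add_apply, single_eq_same, Nat.factorial_succ, Nat.cast_mul, mul_assoc]
  congr 1
  refine congrArg _ (Finset.prod_congr rfl fun j hj => ?_)
  rw [Finset.mem_compl, Finset.mem_singleton] at hj
  rw [Finsupp.add_apply, single_eq_of_ne hj, add_zero]

/-- **The Fischer (Fock, contravariant) pairing** `⟪f, g⟫ = Σ_m m! · f_m · g_m` on `ℂ[X_σ]` — the bilinear form for
which multiplication by `X_i` and `∂_i` are mutually transpose.  (Its Hermitian version `⟪f, ḡ⟫` is the Bargmann–Fock
inner product; see `fischer_conj_self`.) -/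
noncomputable def fischer : MvPolynomial σ ℂ →ₗ[ℂ] MvPolynomial σ ℂ →ₗ[ℂ] ℂ :=
  (basisMonomials σ ℂ).constr ℂ fun m =>
    (basisMonomials σ ℂ).constr ℂ fun m' => if m = m' then mfact m else 0

/-- (Ported verbatim from the HodgeCMPerL package; no docstring in the source.) -/
theorem fischer_monomial_monomial (m m' : σ →₀ ℕ) (a b : ℂ) :
    fischer (monomial m a) (monomial m' b) = if m = m' then mfact m * a * b else 0 := by
  have ha : monomial m a = a • basisMonomials σ ℂ m := by
    rw [coe_basisMonomials, smul_monomial, smul_eq_mul, mul_one]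
  have hb : monomial m' b = b • basisMonomials σ ℂ m' := by
    rw [coe_basisMonomials, smul_monomial, smul_eq_mul, mul_one]
  rw [ha, hb, LinearMap.map_smul₂, map_smul, fischer, Module.Basis.constr_basis, Module.Basis.constr_basis]
  simp only [smul_eq_mul]
  split_ifs <;> ring

/-- `⟪f, X^m⟫ = m! f_m`: the pairing reads off coefficients -/
theorem fischer_monomial_right (f : MvPolynomial σ ℂ) (m : σ →₀ ℕ) :
    fischer f (monomial m 1) = mfact m * coeff m f := by
  induction f using MvPolynomial.induction_on' with
  | monomial m' a =>
    rw [fischer_monomial_monomial, coeff_monomial]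
    split_ifs with h
    · rw [h, mul_one]
    · rw [mul_zero]
  | add p q hp hq => rw [map_add, LinearMap.add_apply, hp, hq, coeff_add, mul_add]

/-- (Ported verbatim from the HodgeCMPerL package; no docstring in the source.) -/
theorem fischer_symm (f g : MvPolynomial σ ℂ) : fischer f g = fischer g f := by
  suffices h : (fischer : MvPolynomial σ ℂ →ₗ[ℂ] MvPolynomial σ ℂ →ₗ[ℂ] ℂ) = fischer.flip from
    LinearMap.congr_fun₂ h f g
  refine (basisMonomials σ ℂ).ext fun m => (basisMonomials σ ℂ).ext fun m' => ?_
  rw [LinearMap.flip_apply, coe_basisMonomials, fischer_monomial_monomial, fischer_monomial_monomial]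
  by_cases h : m = m'
  · subst h
    rfl
  · rw [if_neg h, if_neg (Ne.symm h)]

/-- **non-degeneracy** -/
theorem fischer_nondegenerate {f : MvPolynomial σ ℂ} (h : ∀ g, fischer f g = 0) : f = 0 := by
  ext m
  have := h (monomial m 1)
  rw [fischer_monomial_right, mul_eq_zero] at this
  rw [coeff_zero]
  exact this.resolve_left (mfact_ne_zero m)

omit [Fintype σ] [DecidableEq σ] in
/-- (Ported verbatim from the HodgeCMPerL package; no docstring in the source.) -/
theorem X_mul_monomial' (i : σ) (m : σ →₀ ℕ) (c : ℂ) : X i * monomial m c = monomial (m + single i 1) c := by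
  rw [add_comm, monomial_single_add, pow_one]

/-- **`X_i` and `∂_i` are transpose to each other**: `⟪X_i f, g⟫ = ⟪f, ∂_i g⟫`. -/
theorem fischer_X_mul (i : σ) (f g : MvPolynomial σ ℂ) : fischer (X i * f) g = fischer f (pderiv i g) := by
  suffices h : (fischer : MvPolynomial σ ℂ →ₗ[ℂ] MvPolynomial σ ℂ →ₗ[ℂ] ℂ).comp (LinearMap.mulLeft ℂ (X i)) =
      fischer.compl₂ ((pderiv i : Derivation ℂ (MvPolynomial σ ℂ) (MvPolynomial σ ℂ)) :
        MvPolynomial σ ℂ →ₗ[ℂ] MvPolynomial σ ℂ) from LinearMap.congr_fun₂ h f g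
  refine (basisMonomials σ ℂ).ext fun m => (basisMonomials σ ℂ).ext fun m' => ?_
  rw [LinearMap.comp_apply, LinearMap.mulLeft_apply, LinearMap.compl₂_apply, coe_basisMonomials]
  change fischer (X i * monomial m 1) (monomial m' 1) = fischer (monomial m 1) (pderiv i (monomial m' 1))
  rw [X_mul_monomial', pderiv_monomial, one_mul, fischer_monomial_monomial, fischer_monomial_monomial, mul_one,
    mul_one, mul_one]
  by_cases h : m + single i 1 = m'
  · have h1 : m' i = m i + 1 := by rw [← h, Finsupp.add_apply, single_eq_same]
    have h2 : m = m' - single i 1 := by rw [← h, add_tsub_cancel_right]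
    rw [if_pos h, if_pos h2, h1, mfact_add_single, mul_comm]
  · rw [if_neg h]
    by_cases hi : m' i = 0
    · rw [hi, Nat.cast_zero, mul_zero, ite_self]
    · rw [if_neg]
      intro h2
      apply h
      rw [h2]
      ext j
      rw [Finsupp.add_apply, Finsupp.tsub_apply]
      by_cases hj : j = i
      · subst hj
        rw [single_eq_same]
        omega
      · rw [single_eq_of_ne hj]
        omega

/-- `⟪∂_i f, g⟫ = ⟪f, X_i g⟫` -/
theorem fischer_pderiv (i : σ) (f g : MvPolynomial σ ℂ) : fischer (pderiv i f) g = fischer f (X i * g) := by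
  rw [fischer_symm, ← fischer_X_mul, fischer_symm]

/-- `⟪X_a ∂_b f, g⟫ = ⟪f, X_b ∂_a g⟫` — polarisations `E_{ab}` and `E_{ba}` are mutually transpose -/
theorem fischer_X_mul_pderiv (a b : σ) (f g : MvPolynomial σ ℂ) :
    fischer (X a * pderiv b f) g = fischer f (X b * pderiv a g) := by
  rw [fischer_X_mul, fischer_pderiv]

/-- weight operators `Σ s_i X_i ∂_i` are self-transpose -/
theorem fischer_weightOp (s : σ → ℤ) (f g : MvPolynomial σ ℂ) :
    fischer (weightOp s f) g = fischer f (weightOp s g) := by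
  simp only [weightOp_apply, map_sum, map_smul, LinearMap.sum_apply, LinearMap.smul_apply, fischer_X_mul_pderiv]

/-- **distinct weight pieces are orthogonal**: `⟪F, G⟫ = 0` for `F ∈` weight-`k`, `G ∈` weight-`k'`, `k ≠ k'` -/
theorem fischer_eq_zero_of_mem_wpiece {s : σ → ℤ} {k k' : ℤ} (hkk' : k ≠ k') {f g : MvPolynomial σ ℂ}
    (hf : f ∈ wpiece s k) (hg : g ∈ wpiece s k') : fischer f g = 0 := by
  have h := fischer_weightOp s f g
  rw [(mem_wpiece_iff s k f).mp hf, (mem_wpiece_iff s k' g).mp hg, LinearMap.map_smul₂, map_smul, smul_eq_mul,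
    smul_eq_mul] at h
  have h2 : ((k : ℂ) - k') * fischer f g = 0 := by rw [sub_mul, h, sub_self]
  rcases mul_eq_zero.mp h2 with h3 | h3
  · exact absurd (by exact_mod_cast sub_eq_zero.mp h3) hkk'
  · exact h3

/-- (Ported verbatim from the HodgeCMPerL package; no docstring in the source.) -/
theorem fischer_monomial_right' (f : MvPolynomial σ ℂ) (m : σ →₀ ℕ) (c : ℂ) :
    fischer f (monomial m c) = mfact m * coeff m f * c := by
  have : monomial m c = c • monomial m (1 : ℂ) := by rw [smul_monomial, smul_eq_mul, mul_one]
  rw [this, map_smul, smul_eq_mul, fischer_monomial_right]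
  ring

/-- expansion over the support of the second argument: `⟪f, g⟫ = Σ_m m! f_m g_m` -/
theorem fischer_eq_sum (f g : MvPolynomial σ ℂ) :
    fischer f g = ∑ m ∈ g.support, mfact m * coeff m f * coeff m g := by
  conv_lhs => rw [g.as_sum]
  rw [map_sum]
  exact Finset.sum_congr rfl fun m _ => fischer_monomial_right' f m _

/-- **The Fock (Bargmann–Fischer) inner product** is the Hermitian version `⟪f, ḡ⟫`: on the diagonal it is
`Σ_m m! |f_m|²`. -/
theorem fischer_conj_self (f : MvPolynomial σ ℂ) :
    fischer f (MvPolynomial.map (starRingEnd ℂ) f) =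
      ∑ m ∈ f.support, mfact m * (Complex.normSq (coeff m f) : ℂ) := by
  rw [fischer_eq_sum, support_map_of_injective f (RingHom.injective _)]
  refine Finset.sum_congr rfl fun m _ => ?_
  rw [coeff_map, mul_assoc, Complex.mul_conj]

/-- … it is real … -/
theorem fischer_conj_self_im (f : MvPolynomial σ ℂ) :
    (fischer f (MvPolynomial.map (starRingEnd ℂ) f)).im = 0 := by
  rw [fischer_conj_self, Complex.im_sum]
  refine Finset.sum_eq_zero fun m _ => ?_
  rw [mfact, ← Nat.cast_prod, ← Complex.ofReal_natCast, ← Complex.ofReal_mul, Complex.ofReal_im]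

/-- **… and positive definite**: `⟪f, f̄⟫ > 0` for `f ≠ 0`.  Hence (with `fischer_osc` below) the oscillator
representation of `𝔲(2,1)` on each `F_k` is by skew-Hermitian operators for a positive definite inner product. -/
theorem fischer_conj_self_pos {f : MvPolynomial σ ℂ} (hf : f ≠ 0) :
    0 < (fischer f (MvPolynomial.map (starRingEnd ℂ) f)).re := by
  rw [fischer_conj_self, Complex.re_sum]
  refine Finset.sum_pos (fun m hm => ?_) (support_nonempty.mpr hf)
  rw [mfact, ← Nat.cast_prod, ← Complex.ofReal_natCast, ← Complex.ofReal_mul, Complex.ofReal_re]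
  refine mul_pos ?_ (Complex.normSq_pos.mpr (MvPolynomial.mem_support_iff.mp hm))
  exact_mod_cast Finset.prod_pos fun j _ => Nat.factorial_pos (m j)

/-- (Ported verbatim from the HodgeCMPerL package; no docstring in the source.) -/
theorem eq_zero_of_fischer_conj_self_eq_zero {f : MvPolynomial σ ℂ}
    (h : fischer f (MvPolynomial.map (starRingEnd ℂ) f) = 0) : f = 0 := by
  by_contra hf
  have := fischer_conj_self_pos hf
  rw [h, Complex.zero_re] at this
  exact lt_irrefl 0 this

end Pairing

/-! ## The oscillator operators on `ℂ[z₁,z₂,w]`: `E_{ab}ᵀ = E_{ba}`, `Hᵀ = H`, `P_aᵀ = Q_a` -/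

section OscillatorTranspose

/-- `⟪E_{ab} f, g⟫ = ⟪f, E_{ba} g⟫` -/
theorem fischer_hE (a b : Fin 2) (f g : HarmModel) : fischer (hE a b f) g = fischer f (hE b a g) := by
  rw [hE_apply, hE_apply, fischer_X_mul_pderiv]

/-- `⟪H f, g⟫ = ⟪f, H g⟫` -/
theorem fischer_hH (f g : HarmModel) : fischer (hH f) g = fischer f (hH g) := by
  rw [hH_apply, hH_apply, fischer_X_mul_pderiv]

/-- **`⟪P_a f, g⟫ = ⟪f, Q_a g⟫`: creation `z_a w` and annihilation `∂_{z_a} ∂_w` are mutually transpose** -/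
theorem fischer_hP (a : Fin 2) (f g : HarmModel) : fischer (hP a f) g = fischer f (hQ a g) := by
  rw [hP_apply, hQ_apply, hz, hw, mul_assoc, fischer_X_mul, fischer_X_mul, pderiv_pderiv_comm]

/-- (Ported verbatim from the HodgeCMPerL package; no docstring in the source.) -/
theorem fischer_hQ (a : Fin 2) (f g : HarmModel) : fischer (hQ a f) g = fischer f (hP a g) := by
  rw [fischer_symm, ← fischer_hP, fischer_symm]

/-- **`F_k ⟂ F_{k'}` for `k ≠ k'`** under the Fischer pairing -/
theorem fischer_eq_zero_of_mem_hpiece {k k' : ℤ} (hkk' : k ≠ k') {f g : HarmModel} (hf : f ∈ hpiece k)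
    (hg : g ∈ hpiece k') : fischer f g = 0 :=
  fischer_eq_zero_of_mem_wpiece hkk' hf hg

/-- the sign `J = diag(1, 1, −1)` pattern of the blocks of `𝔤𝔩₃ = 𝔤𝔩(ℂ² ⊕ ℂ)`: `+1` on the diagonal blocks, `−1` off -/
def blockSign : HarmVar → HarmVar → ℂ
  | Sum.inl _, Sum.inl _ => 1
  | Sum.inr _, Sum.inr _ => 1
  | Sum.inl _, Sum.inr _ => -1
  | Sum.inr _, Sum.inl _ => -1

/-- **Transpose of the oscillator representation**: `⟪osc_{ij} f, g⟫ = J_i J_j ⟪f, osc_{ji} g⟫`, i.e.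
`osc(A)ᵀ = osc(J Aᵀ J)` with `J = diag(1,1,−1)` — the matrices `A` with `J Āᵀ J = −A`, which form `𝔲(2,1)`, act by
operators that are skew-Hermitian for the Fock inner product `⟪f, ḡ⟫` (formal unitarity of the oscillator
representation of `𝔲(2,1)` on every `F_k`). -/
theorem fischer_osc (i j : HarmVar) (f g : HarmModel) :
    fischer (osc i j f) g = blockSign i j * fischer f (osc j i g) := by
  rcases i with a | ⟨⟩ <;> rcases j with b | ⟨⟩
  · simp only [osc, blockSign, LinearMap.add_apply, map_add, LinearMap.add_apply, fischer_hE, one_mul]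
    by_cases hab : a = b
    · subst hab
      simp
    · simp [hab, Ne.symm hab]
  · simp only [osc, blockSign, fischer_hP, LinearMap.neg_apply, map_neg, neg_mul, one_mul, neg_neg]
  · simp only [osc, blockSign, LinearMap.neg_apply, map_neg, LinearMap.neg_apply, fischer_hQ, neg_mul, one_mul]
  · simp only [osc, blockSign, LinearMap.neg_apply, map_neg, LinearMap.neg_apply, fischer_hH, one_mul]

/-- `J = diag(1, 1, −1)` as signs on the variables (`z_a ↦ +1`, `w ↦ −1`) -/
def jsign : HarmVar → ℂ
  | Sum.inl _ => 1
  | Sum.inr _ => -1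

/-- (Ported verbatim from the HodgeCMPerL package; no docstring in the source.) -/
theorem blockSign_eq (i j : HarmVar) : blockSign i j = jsign i * jsign j := by
  rcases i with _ | ⟨⟩ <;> rcases j with _ | ⟨⟩ <;> simp [blockSign, jsign]

/-- the matrix `J = diag(1, 1, −1)` of the Hermitian form of signature `(2,1)` defining `U(2,1)` -/
noncomputable def jmat : Matrix HarmVar HarmVar ℂ := Matrix.diagonal jsign

/-- **Matrix form of the transpose relation: `osc(A)ᵀ = osc(J Aᵀ J)`** for the Fischer pairing, `J = diag(1,1,−1)`.
Consequently every `A ∈ 𝔲(2,1) = {A : J Āᵀ J = −A}` acts on `ℂ[z₁,z₂,w]` (and on each `F_k`) by an operator that is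
skew-Hermitian for the Fock inner product `⟪f, ḡ⟫`. -/
theorem fischer_oscRep (A : Matrix HarmVar HarmVar ℂ) (f g : HarmModel) :
    fischer (oscRep A f) g = fischer f (oscRep (jmat * A.transpose * jmat) g) := by
  rw [oscRep_apply, oscRep_apply]
  simp only [LinearMap.sum_apply, LinearMap.smul_apply, map_sum, map_smul, smul_eq_mul, fischer_osc, blockSign_eq, jmat, Matrix.mul_diagonal, Matrix.diagonal_mul, Matrix.transpose_apply]
  rw [Finset.sum_comm]
  refine Finset.sum_congr rfl fun i _ => Finset.sum_congr rfl fun j _ => ?_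
  ring

end OscillatorTranspose

/-! ## The definite pair `(U(1), U(3))`: `dE_{ab}ᵀ = dE_{ba}`, `dERep(A)ᵀ = dERep(Aᵀ)` -/

section DefiniteTranspose

/-- `⟪z_a ∂_b f, g⟫ = ⟪f, z_b ∂_a g⟫` on `ℂ[z₁,z₂,z₃]` -/
theorem fischer_dE (a b : Fin 3) (f g : DefModel) : fischer (dE a b f) g = fischer f (dE b a g) := by
  rw [dE_apply, dE_apply, fischer_X_mul_pderiv]

/-- **`dERep(A)ᵀ = dERep(Aᵀ)`**: every `A ∈ 𝔲(3) = {A : Āᵀ = −A}` acts on `ℂ[z₁,z₂,z₃]` (and on each `Sym^d`) by a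
skew-Hermitian operator for the Fock inner product — formal unitarity for the compact dual pair. -/
theorem fischer_dERep (A : Matrix (Fin 3) (Fin 3) ℂ) (f g : DefModel) :
    fischer (dERep A f) g = fischer f (dERep A.transpose g) := by
  rw [dERep_apply, dERep_apply]
  simp only [LinearMap.sum_apply, LinearMap.smul_apply, map_sum, map_smul, smul_eq_mul, fischer_dE,
    Matrix.transpose_apply]
  rw [Finset.sum_comm]

/-- `Sym^d ⟂ Sym^{d'}` for `d ≠ d'` -/
theorem fischer_eq_zero_of_mem_dpiece {d d' : ℕ} (hdd' : d ≠ d') {f g : DefModel} (hf : f ∈ dpiece d)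
    (hg : g ∈ dpiece d') : fischer f g = 0 :=
  fischer_eq_zero_of_mem_wpiece (fun h => hdd' (by exact_mod_cast h)) hf hg

end DefiniteTranspose

end Fock

end PerL34

end HodgeCM
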